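import Mathlib
import Summits.CriticalPhenomena.CardyFormulaZ2.Cruxes.ParafermionToSLESixFamilies.FirstLemmasIdeator3

/-!
# Triage r1/3 — the first lemma `FoliationIdentification` of card `left-passage-foliation-lock`
# is FALSE as typed (missing range hypothesis `0 ≤ ℓ ≤ 1`).

Witness: `α = 0`, `β = π`, `G = id`, `ℓ = H = arcHM 0 π + P` with `P z = Re((1+z)/(1-z))` the
Poisson kernel at the endpoint `e^{i·0} = 1` of the arc: harmonic on the disc, `→ 0` at every
boundary point `≠ 1`, unbounded along the radius to `1`; so all hypotheses hold while
`H - c₀ - c₁·arcHM` is unbounded for every `c₀, c₁`.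
Repair (what the card uses informally): add `∀ z ∈ ball 0 1, ℓ z ∈ Icc 0 1`.
-/

namespace Summit.CriticalPhenomena.CardyFormulaZ2.Cruxes.ParafermionToSLESixFamilies.Triage3

open scoped Topology Real
open Filter Set Metric Complex InnerProductSpace
open Literature.Analysis.Complex

private theorem one_sub_ne_zero_of_mem_ball {z : ℂ} (hz : z ∈ ball (0:ℂ) 1) : (1:ℂ) - z ≠ 0 := by
  intro h
  have hz1 : z = 1 := by linear_combination -h
  rw [hz1, mem_ball_zero_iff, norm_one] at hz
  exact lt_irrefl _ hz

private theorem analyticAt_cayley {z : ℂ} (hz : (1:ℂ) - z ≠ 0) :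
    AnalyticAt ℂ (fun w : ℂ => (1 + w) / (1 - w)) z :=
  (analyticAt_const.add analyticAt_id).div (analyticAt_const.sub analyticAt_id) hz

private theorem continuousAt_P {z : ℂ} (hz : (1:ℂ) - z ≠ 0) :
    ContinuousAt (fun w : ℂ => ((1 + w) / (1 - w)).re) z :=
  Complex.continuous_re.continuousAt.comp
    ((continuous_const.add continuous_id).continuousAt.div
      (continuous_const.sub continuous_id).continuousAt hz)

private theorem exp_ne_one {t : ℝ} (h0 : 0 < t) (h1 : t < 2 * π) : Complex.exp (t * I) ≠ 1 := by
  intro h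
  have hre := congrArg Complex.re h
  rw [exp_ofReal_mul_I_re, one_re] at hre
  have := (Real.cos_eq_one_iff_of_lt_of_lt (by linarith) h1).1 hre
  linarith

private theorem tendsto_P {t : ℝ} (ht : Complex.exp (t * I) ≠ 1) :
    Tendsto (fun w : ℂ => ((1 + w) / (1 - w)).re) (𝓝[ball (0:ℂ) 1] (exp (t * I))) (𝓝 0) := by
  have hne : (1:ℂ) - exp (t * I) ≠ 0 := sub_ne_zero.2 (Ne.symm ht)
  have h0 : ((1 + exp (t * I)) / (1 - exp (t * I))).re = 0 := by
    rw [Complex.div_re, ← add_div, div_eq_zero_iff]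
    left
    simp only [add_re, one_re, sub_re, add_im, one_im, sub_im, exp_ofReal_mul_I_re,
      exp_ofReal_mul_I_im, zero_add, zero_sub]
    have := Real.sin_sq_add_cos_sq t
    nlinarith [this]
  have h1 := (continuousAt_P hne).tendsto
  rw [h0] at h1
  exact h1.mono_left nhdsWithin_le_nhds

/-- The typed first lemma of card `left-passage-foliation-lock` is false. -/
theorem foliationIdentification_false : ¬ Sketch.FoliationIdentification := by
  intro h
  have hπ : (0:ℝ) < π := Real.pi_pos
  have h2π : π - 0 < 2 * π := by linarith
  set P : ℂ → ℝ := fun w => ((1 + w) / (1 - w)).re with hP_def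
  have hPh : HarmonicOnNhd P (ball (0:ℂ) 1) := fun z hz =>
    (analyticAt_cayley (one_sub_ne_zero_of_mem_ball hz)).harmonicAt_re
  have harm : HarmonicOnNhd (fun z => arcHM 0 π z + P z) (ball (0:ℂ) 1) :=
    (harmonicOnNhd_arcHM hπ h2π).add hPh
  have cont : ContinuousOn (fun z => arcHM 0 π z + P z) (ball (0:ℂ) 1) := fun z hz =>
    ((continuousAt_arcHM hπ h2π hz).add
      (continuousAt_P (one_sub_ne_zero_of_mem_ball hz))).continuousWithinAt
  have lim1 : ∀ t ∈ Ioo (0:ℝ) π,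
      Tendsto (fun z => arcHM 0 π z + P z) (𝓝[ball (0:ℂ) 1] (exp (t * I))) (𝓝 1) := by
    intro t ht
    have h1 := tendsto_arcHM_one h2π ht
    have h2 := tendsto_P (exp_ne_one (t := t) ht.1 (by linarith [ht.2]))
    simpa using h1.add h2
  have lim0 : ∀ t ∈ Ioo π (0 + 2 * π),
      Tendsto (fun z => arcHM 0 π z + P z) (𝓝[ball (0:ℂ) 1] (exp (t * I))) (𝓝 0) := by
    intro t ht
    have h1 := tendsto_arcHM_zero hπ ht
    have h2 := tendsto_P (exp_ne_one (t := t) (by linarith [ht.1]) (by linarith [ht.2]))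
    simpa using h1.add h2
  obtain ⟨c₀, c₁, hc⟩ := h 0 π hπ h2π _ _ id harm cont lim1 lim0 (fun z _ => rfl)
  set M : ℝ := |c₀| + |c₁ - 1| with hM
  have hM0 : 0 ≤ M := by positivity
  set r : ℝ := 1 - 1 / (M + 2) with hr
  have hq0 : 0 < 1 / (M + 2) := by positivity
  have hq1 : 1 / (M + 2) ≤ 1 / 2 := by
    apply div_le_div_of_nonneg_left (by norm_num) (by norm_num) (by linarith)
  have hrpos : 0 < r := by rw [hr]; linarith
  have hrlt : r < 1 := by rw [hr]; linarith
  have hrball : (r:ℂ) ∈ ball (0:ℂ) 1 := by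
    rw [mem_ball_zero_iff, Complex.norm_real, Real.norm_eq_abs, abs_of_pos hrpos]
    exact hrlt
  have hPr : P r = (1 + r) / (1 - r) := by
    simp only [hP_def]
    have : (1 + (r:ℂ)) / (1 - (r:ℂ)) = (((1 + r) / (1 - r) : ℝ) : ℂ) := by push_cast; ring
    rw [this, ofReal_re]
  have hbig : M + 2 ≤ P r := by
    have h1r : 1 - r = 1 / (M + 2) := by rw [hr]; ring
    rw [hPr, h1r, one_div, div_inv_eq_mul]
    nlinarith
  have hsmall : P r ≤ M := by
    have hcr := hc r hrball
    have hP' : P r = c₀ + (c₁ - 1) * arcHM 0 π r := by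
      have : arcHM 0 π r + P r = c₀ + c₁ * arcHM 0 π r := hcr
      linarith
    have ha0 := arcHM_nonneg hπ h2π hrball
    have ha1 := arcHM_le_one 0 π (r:ℂ)
    have e1 : (c₁ - 1) * arcHM 0 π r ≤ |c₁ - 1| * arcHM 0 π r :=
      mul_le_mul_of_nonneg_right (le_abs_self _) ha0
    have e2 : |c₁ - 1| * arcHM 0 π r ≤ |c₁ - 1| := mul_le_of_le_one_right (abs_nonneg _) ha1
    rw [hP', hM]
    linarith [le_abs_self c₀]
  linarith

end Summit.CriticalPhenomena.CardyFormulaZ2.Cruxes.ParafermionToSLESixFamilies.Triage3
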